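import Mathlib
import Summits.PneNP.PneNP.Theorems.ConvexRankGatesConvexGateBlindRainbowSums

/-!
# PneNP / ConvexRankGates — `ConvexGateBlind`: re-centring inside a vertex set and the superset-averaging identity

Helpers (`--supports stmt-PneNP-10680`), COLUMN-SPACE line (prover seat 2, session 19). First brick of the UNCONDITIONAL
linear bound on the ℓ₁-constant of clique-non-negative weightings (replacing the Montgomery hypothesis of
`…L1Montgomery` / `…ColumnSpaceHalf`).

For a symmetric `F : Fin m → Fin m → ℝ` and a vertex set `W` (`w = #W`) put `deg_W F x = ∑_{z ∈ W ∖ x} F x z`,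
`tot_W F = ∑_{x∈W} deg_W F x` and

  `rc_W F (x,y) = F x y − (deg_W F x + deg_W F y)/(w−2) + tot_W F/((w−1)(w−2))`

(the Johnson `V₂`-projection of `F|_W`, i.e. `F|_W` re-centred to ZERO ROW SUMS inside `W`: `sum_poolRc_row`). Main result
(`sum_poolRc_family`, SUPERSET AVERAGING): for a family `(W_i)` of `w`-subsets of `U` through `x,y` whose incidence counts with one
/ two further vertices are constants `N₁, N₂` with `(u−2)N₁ = (w−2)N₀`, `(u−3)N₂ = (w−3)N₁`,
`∑_i rc_{W_i} F(x,y) = N₀ · c(u,w) · rc_U F(x,y)` with the explicit `c(u,w) = poolCoef u w` (instantiated for pools and pool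
complements in `…PoolCounting`). Also: `c(u,u) = 1`, the cocycle `c(w,n)c(u,w) = c(u,n)`, and `c(u,n) ≥ (n−3)/(n−1)`
(`poolCoef_ge`). PURPOSE: the pool measure of `…PoolMeasure` draws one pair per random pool with bias `1 + η·rc_P F`; zero row
sums make its vertex marginals exactly uniform and superset averaging makes its pair marginals exactly affine in `rc_U F`. [new]
-/

set_option linter.dupNamespace false

namespace Summit.PneNP.PneNP.Theorems

open Finset

noncomputable section

variable {m : ℕ}

/-! ## Definitions -/

/-- Degree of `x` inside `W` for the weighting `F`: `∑_{z ∈ W ∖ x} F x z`. [new] -/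
def poolDeg (W : Finset (Fin m)) (F : Fin m → Fin m → ℝ) (x : Fin m) : ℝ := ∑ z ∈ W.erase x, F x z

/-- Total (ordered) mass of `F` inside `W`: `∑_{x ∈ W} deg_W F x`. [new] -/
def poolTot (W : Finset (Fin m)) (F : Fin m → Fin m → ℝ) : ℝ := ∑ x ∈ W, poolDeg W F x

/-- `F` re-centred inside `W` (`w = #W`): `F x y − (deg_W x + deg_W y)/(w−2) + tot_W/((w−1)(w−2))`; its row sums inside `W`
vanish (`sum_poolRc_row`). [new] -/
def poolRc (W : Finset (Fin m)) (F : Fin m → Fin m → ℝ) (x y : Fin m) : ℝ :=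
  F x y - (poolDeg W F x + poolDeg W F y) / ((W.card : ℝ) - 2) + poolTot W F / (((W.card : ℝ) - 1) * ((W.card : ℝ) - 2))

/-- The superset-averaging coefficient `c(u,w) = 1 − 2(u−w)/((u−2)(w−2)) + 2(u−w)(u−w−1)/((w−1)(w−2)(u−2)(u−3))`. [new] -/
def poolCoef (u w : ℝ) : ℝ :=
  1 - 2 * (u - w) / ((u - 2) * (w - 2)) + 2 * (u - w) * (u - w - 1) / ((w - 1) * (w - 2) * (u - 2) * (u - 3))

/-! ## Elementary facts -/

/-- The re-centred weighting of a symmetric `F` is symmetric. [new] -/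
theorem poolRc_symm (W : Finset (Fin m)) (F : Fin m → Fin m → ℝ) (hF : ∀ a b, F a b = F b a) (x y : Fin m) :
    poolRc W F x y = poolRc W F y x := by
  unfold poolRc; rw [hF x y, add_comm (poolDeg W F x)]

/-- `∑_{y ∈ W ∖ x} deg_W F y = tot_W F − deg_W F x`. [new] -/
theorem sum_erase_poolDeg (W : Finset (Fin m)) (F : Fin m → Fin m → ℝ) {x : Fin m} (hx : x ∈ W) :
    ∑ y ∈ W.erase x, poolDeg W F y = poolTot W F - poolDeg W F x := by
  unfold poolTot; rw [Finset.sum_erase_eq_sub hx]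

/-- **Zero row sums of the re-centred weighting.** For `x ∈ W`, `#W ≥ 3`: `∑_{y ∈ W ∖ x} rc_W F (x,y) = 0`. [new] -/
theorem sum_poolRc_row (W : Finset (Fin m)) (F : Fin m → Fin m → ℝ) {x : Fin m} (hx : x ∈ W) (hW : 3 ≤ W.card) :
    ∑ y ∈ W.erase x, poolRc W F x y = 0 := by
  unfold poolRc
  rw [Finset.sum_add_distrib, Finset.sum_sub_distrib, ← Finset.sum_div, Finset.sum_add_distrib, Finset.sum_const,
    sum_erase_poolDeg W F hx, Finset.sum_const, Finset.card_erase_of_mem hx]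
  have hpd : ∑ y ∈ W.erase x, F x y = poolDeg W F x := rfl
  rw [hpd, nsmul_eq_mul, nsmul_eq_mul]
  have hc : ((W.card - 1 : ℕ) : ℝ) = (W.card : ℝ) - 1 := by
    rw [Nat.cast_sub (by omega), Nat.cast_one]
  rw [hc]
  have hW3 : (3 : ℝ) ≤ W.card := by exact_mod_cast hW
  have h1 : (W.card : ℝ) - 2 ≠ 0 := by linarith
  have h2 : (W.card : ℝ) - 1 ≠ 0 := by linarith
  field_simp
  ring

/-- Degrees of a non-negative weighting are non-negative. [new] -/
theorem poolDeg_nonneg (W : Finset (Fin m)) (F : Fin m → Fin m → ℝ) (hF0 : ∀ a b, 0 ≤ F a b) (x : Fin m) :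
    0 ≤ poolDeg W F x := Finset.sum_nonneg fun z _ => hF0 x z

/-- Degrees of a weighting bounded by `1` are at most `#W − 1`. [new] -/
theorem poolDeg_le (W : Finset (Fin m)) (F : Fin m → Fin m → ℝ) (hF1 : ∀ a b, F a b ≤ 1) {x : Fin m} (hx : x ∈ W) :
    poolDeg W F x ≤ (W.card : ℝ) - 1 := by
  unfold poolDeg
  calc ∑ z ∈ W.erase x, F x z ≤ ∑ z ∈ W.erase x, (1 : ℝ) := Finset.sum_le_sum fun z _ => hF1 x z
    _ = (W.card : ℝ) - 1 := by
        rw [Finset.sum_const, nsmul_eq_mul, mul_one, Finset.card_erase_of_mem hx, Nat.cast_sub (by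
          exact Finset.card_pos.2 ⟨x, hx⟩), Nat.cast_one]

/-- The total of a non-negative weighting is non-negative. [new] -/
theorem poolTot_nonneg (W : Finset (Fin m)) (F : Fin m → Fin m → ℝ) (hF0 : ∀ a b, 0 ≤ F a b) : 0 ≤ poolTot W F :=
  Finset.sum_nonneg fun x _ => poolDeg_nonneg W F hF0 x

/-- **Lower bound on the re-centred weighting of a `[0,1]`-valued `F`:** `rc_W F ≥ −3` once `#W ≥ 4`. [new] -/
theorem neg_three_le_poolRc (W : Finset (Fin m)) (F : Fin m → Fin m → ℝ) (hF0 : ∀ a b, 0 ≤ F a b) (hF1 : ∀ a b, F a b ≤ 1)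
    (hW : 4 ≤ W.card) {x y : Fin m} (hx : x ∈ W) (hy : y ∈ W) : -3 ≤ poolRc W F x y := by
  unfold poolRc
  have hW4 : (4 : ℝ) ≤ W.card := by exact_mod_cast hW
  have h2 : 0 < (W.card : ℝ) - 2 := by linarith
  have h12 : 0 < ((W.card : ℝ) - 1) * ((W.card : ℝ) - 2) := mul_pos (by linarith) h2
  have hdx := poolDeg_le W F hF1 hx
  have hdy := poolDeg_le W F hF1 hy
  have hT := poolTot_nonneg W F hF0
  have hA : (poolDeg W F x + poolDeg W F y) / ((W.card : ℝ) - 2) ≤ 3 := by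
    rw [div_le_iff₀ h2]; linarith
  have hB : 0 ≤ poolTot W F / (((W.card : ℝ) - 1) * ((W.card : ℝ) - 2)) := div_nonneg hT h12.le
  linarith [hF0 x y]

/-! ## Algebra of the coefficient `c(u,w)` -/

/-- `c(u,u) = 1`. [new] -/
theorem poolCoef_self {u : ℝ} (hu : 4 ≤ u) : poolCoef u u = 1 := by
  unfold poolCoef
  have h1 : u - 2 ≠ 0 := by linarith
  have h2 : u - 1 ≠ 0 := by linarith
  have h3 : u - 3 ≠ 0 := by linarith
  field_simp
  ring

/-- **Cocycle identity** `c(w,n)·c(u,w) = c(u,n)` (`4 ≤ n ≤ w ≤ u`). [new] -/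
theorem poolCoef_cocycle {u w n : ℝ} (hn : 4 ≤ n) (hnw : n ≤ w) (hwu : w ≤ u) : poolCoef w n * poolCoef u w = poolCoef u n := by
  unfold poolCoef
  have h1 : u - 2 ≠ 0 := by linarith
  have h2 : u - 1 ≠ 0 := by linarith
  have h3 : u - 3 ≠ 0 := by linarith
  have h4 : w - 2 ≠ 0 := by linarith
  have h5 : w - 1 ≠ 0 := by linarith
  have h6 : w - 3 ≠ 0 := by linarith
  have h7 : n - 2 ≠ 0 := by linarith
  have h8 : n - 1 ≠ 0 := by linarith
  have h9 : n - 3 ≠ 0 := by linarith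
  field_simp
  ring

/-- **Lower bound** `c(u,n) ≥ (n−3)/(n−1)` for `4 ≤ n ≤ u`. [new] -/
theorem poolCoef_ge {u n : ℝ} (hn : 4 ≤ n) (hnu : n ≤ u) : (n - 3) / (n - 1) ≤ poolCoef u n := by
  have h1 : 0 < u - 2 := by linarith
  have h2 : 0 < n - 1 := by linarith
  have h3 : 0 < u - 3 := by linarith
  have h4 : 0 < n - 2 := by linarith
  -- certificate: `c(u,n) − (n−3)/(n−1) = 2[(n−2)²(n−3) + (u−n)(n−2)(n−3)] / ((n−1)(n−2)(u−2)(u−3)) ≥ 0`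
  have key : poolCoef u n - (n - 3) / (n - 1) =
      2 * ((n - 2) ^ 2 * (n - 3) + (u - n) * (n - 2) * (n - 3)) / ((n - 1) * (n - 2) * (u - 2) * (u - 3)) := by
    unfold poolCoef
    field_simp
    ring
  have hnum : 0 ≤ 2 * ((n - 2) ^ 2 * (n - 3) + (u - n) * (n - 2) * (n - 3)) := by
    have : (0 : ℝ) ≤ n - 3 := by linarith
    have : (0 : ℝ) ≤ u - n := by linarith
    positivity
  have : 0 ≤ poolCoef u n - (n - 3) / (n - 1) := by rw [key]; positivity
  linarith


/-! ## Swapping sums over a family of vertex sets -/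

/-- **Swap lemma.** For a family `(W_i)` of subsets of `U`:
`∑_{i : a ∈ W_i} deg_{W_i} F a = ∑_{b ∈ U ∖ a} F a b · #{i : a ∈ W_i ∧ b ∈ W_i}`. [new] -/
theorem sum_filter_poolDeg {ι : Type*} (I : Finset ι) (W : ι → Finset (Fin m)) (U : Finset (Fin m))
    (F : Fin m → Fin m → ℝ) (a : Fin m) (hWU : ∀ i ∈ I, W i ⊆ U) :
    ∑ i ∈ I.filter (fun i => a ∈ W i), poolDeg (W i) F a =
      ∑ b ∈ U.erase a, F a b * ((I.filter (fun i => a ∈ W i ∧ b ∈ W i)).card : ℝ) := by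
  classical
  have hstep : ∀ i ∈ I.filter (fun i => a ∈ W i),
      poolDeg (W i) F a = ∑ b ∈ U.erase a, if b ∈ W i then F a b else 0 := by
    intro i hi
    rw [Finset.mem_filter] at hi
    unfold poolDeg
    rw [← Finset.sum_filter]
    congr 1
    ext b
    simp only [Finset.mem_erase, Finset.mem_filter]
    constructor
    · rintro ⟨hba, hbW⟩; exact ⟨⟨hba, hWU i hi.1 hbW⟩, hbW⟩
    · rintro ⟨⟨hba, _⟩, hbW⟩; exact ⟨hba, hbW⟩
  rw [Finset.sum_congr rfl hstep, Finset.sum_comm]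
  refine Finset.sum_congr rfl fun b _ => ?_
  rw [← Finset.sum_filter, Finset.filter_filter, Finset.sum_const, nsmul_eq_mul, mul_comm]

/-- Swap lemma, total form: `∑_i tot_{W_i} F = ∑_{a ∈ U} ∑_{i : a ∈ W_i} deg_{W_i} F a`. [new] -/
theorem sum_poolTot_eq {ι : Type*} (I : Finset ι) (W : ι → Finset (Fin m)) (U : Finset (Fin m))
    (F : Fin m → Fin m → ℝ) (hWU : ∀ i ∈ I, W i ⊆ U) :
    ∑ i ∈ I, poolTot (W i) F = ∑ a ∈ U, ∑ i ∈ I.filter (fun i => a ∈ W i), poolDeg (W i) F a := by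
  classical
  unfold poolTot
  have hstep : ∀ i ∈ I, ∑ a ∈ W i, poolDeg (W i) F a = ∑ a ∈ U, if a ∈ W i then poolDeg (W i) F a else 0 := by
    intro i hi
    rw [← Finset.sum_filter]
    congr 1
    ext a
    simp only [Finset.mem_filter]
    exact ⟨fun h => ⟨hWU i hi h, h⟩, fun h => h.2⟩
  rw [Finset.sum_congr rfl hstep, Finset.sum_comm]
  refine Finset.sum_congr rfl fun a _ => ?_
  rw [← Finset.sum_filter]

/-! ## The superset-averaging identity -/

/-- Row sums of the family at the two marked vertices: with all `W_i ∋ x, y`,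
`∑_i deg_{W_i} F x = N₀·F x y + N₁·(deg_U F x − F x y)`. [new] -/
theorem sum_poolDeg_marked {ι : Type*} (I : Finset ι) (W : ι → Finset (Fin m)) (U : Finset (Fin m))
    (F : Fin m → Fin m → ℝ) {x y : Fin m} (hxy : x ≠ y) (hy : y ∈ U)
    (hWU : ∀ i ∈ I, W i ⊆ U) (hWx : ∀ i ∈ I, x ∈ W i) (hWy : ∀ i ∈ I, y ∈ W i) (N₀ N₁ : ℝ)
    (hN₀ : (I.card : ℝ) = N₀)
    (hN₁ : ∀ z ∈ U, z ≠ x → z ≠ y → ((I.filter (fun i => z ∈ W i)).card : ℝ) = N₁) :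
    ∑ i ∈ I, poolDeg (W i) F x = N₀ * F x y + N₁ * (poolDeg U F x - F x y) := by
  classical
  have hI : I.filter (fun i => x ∈ W i) = I := Finset.filter_true_of_mem hWx
  have h := sum_filter_poolDeg I W U F x hWU
  rw [hI] at h
  rw [h]
  have hyU : y ∈ U.erase x := Finset.mem_erase.2 ⟨hxy.symm, hy⟩
  rw [← Finset.add_sum_erase _ _ hyU]
  have hcnt_y : ((I.filter (fun i => x ∈ W i ∧ y ∈ W i)).card : ℝ) = N₀ := by
    rw [Finset.filter_true_of_mem (fun i hi => ⟨hWx i hi, hWy i hi⟩), hN₀]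
  have hcnt : ∀ b ∈ (U.erase x).erase y, ((I.filter (fun i => x ∈ W i ∧ b ∈ W i)).card : ℝ) = N₁ := by
    intro b hb
    simp only [Finset.mem_erase] at hb
    have : I.filter (fun i => x ∈ W i ∧ b ∈ W i) = I.filter (fun i => b ∈ W i) :=
      Finset.filter_congr (fun i hi => ⟨fun h => h.2, fun h => ⟨hWx i hi, h⟩⟩)
    rw [this]
    exact hN₁ b hb.2.2 hb.2.1 hb.1
  rw [hcnt_y, Finset.sum_congr rfl (fun b hb => by rw [hcnt b hb])]
  unfold poolDeg
  rw [← Finset.add_sum_erase _ _ hyU, ← Finset.sum_mul]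
  ring

/-- Row sums of the family at an unmarked vertex `a ∉ {x,y}`:
`∑_{i : a ∈ W_i} deg_{W_i} F a = N₁·(F a x + F a y) + N₂·(deg_U F a − F a x − F a y)`. [new] -/
theorem sum_poolDeg_unmarked {ι : Type*} (I : Finset ι) (W : ι → Finset (Fin m)) (U : Finset (Fin m))
    (F : Fin m → Fin m → ℝ) {x y a : Fin m} (hxy : x ≠ y) (hx : x ∈ U) (hy : y ∈ U) (ha : a ∈ U)
    (hax : a ≠ x) (hay : a ≠ y)
    (hWx : ∀ i ∈ I, x ∈ W i) (hWy : ∀ i ∈ I, y ∈ W i) (hWU : ∀ i ∈ I, W i ⊆ U) (N₁ N₂ : ℝ)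
    (hN₁ : ∀ z ∈ U, z ≠ x → z ≠ y → ((I.filter (fun i => z ∈ W i)).card : ℝ) = N₁)
    (hN₂ : ∀ z ∈ U, ∀ z' ∈ U, z ≠ x → z ≠ y → z' ≠ x → z' ≠ y → z ≠ z' →
      ((I.filter (fun i => z ∈ W i ∧ z' ∈ W i)).card : ℝ) = N₂) :
    ∑ i ∈ I.filter (fun i => a ∈ W i), poolDeg (W i) F a =
      N₁ * (F a x + F a y) + N₂ * (poolDeg U F a - F a x - F a y) := by
  classical
  rw [sum_filter_poolDeg I W U F a hWU]
  have hxU : x ∈ U.erase a := Finset.mem_erase.2 ⟨hax.symm, hx⟩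
  have hyU : y ∈ (U.erase a).erase x := Finset.mem_erase.2 ⟨hxy.symm, Finset.mem_erase.2 ⟨hay.symm, hy⟩⟩
  rw [← Finset.add_sum_erase _ _ hxU, ← Finset.add_sum_erase _ _ hyU]
  have hcx : ((I.filter (fun i => a ∈ W i ∧ x ∈ W i)).card : ℝ) = N₁ := by
    rw [Finset.filter_congr (fun i hi => ⟨fun h => h.1, fun h => ⟨h, hWx i hi⟩⟩)]
    exact hN₁ a ha hax hay
  have hcy : ((I.filter (fun i => a ∈ W i ∧ y ∈ W i)).card : ℝ) = N₁ := by
    rw [Finset.filter_congr (fun i hi => ⟨fun h => h.1, fun h => ⟨h, hWy i hi⟩⟩)]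
    exact hN₁ a ha hax hay
  have hcb : ∀ b ∈ ((U.erase a).erase x).erase y, ((I.filter (fun i => a ∈ W i ∧ b ∈ W i)).card : ℝ) = N₂ := by
    intro b hb
    simp only [Finset.mem_erase] at hb
    exact hN₂ a ha b hb.2.2.2 hax hay hb.2.1 hb.1 (Ne.symm hb.2.2.1)
  rw [hcx, hcy, Finset.sum_congr rfl (fun b hb => by rw [hcb b hb])]
  unfold poolDeg
  rw [← Finset.add_sum_erase _ _ hxU, ← Finset.add_sum_erase _ _ hyU, ← Finset.sum_mul]
  ring

/-- **Superset averaging.** Let `(W_i)_{i ∈ I}` be `w`-subsets of `U` (`4 ≤ w ≤ #U`) all containing `x ≠ y`, such that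
every further vertex `z` lies in `N₁` of them and every further pair `z ≠ z'` in `N₂` of them, where `#I = N₀`,
`(u−2)N₁ = (w−2)N₀`, `(u−3)N₂ = (w−3)N₁`. Then `∑_i rc_{W_i} F(x,y) = N₀ · c(u,w) · rc_U F(x,y)`. [new] -/
theorem sum_poolRc_family {ι : Type*} (I : Finset ι) (W : ι → Finset (Fin m)) (U : Finset (Fin m))
    (F : Fin m → Fin m → ℝ) (hF : ∀ a b, F a b = F b a) {x y : Fin m} (hxy : x ≠ y) (hx : x ∈ U) (hy : y ∈ U)
    {w : ℕ} (hw : 4 ≤ w) (hwU : w ≤ U.card)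
    (hWc : ∀ i ∈ I, (W i).card = w) (hWU : ∀ i ∈ I, W i ⊆ U) (hWx : ∀ i ∈ I, x ∈ W i) (hWy : ∀ i ∈ I, y ∈ W i)
    (N₀ N₁ N₂ : ℝ) (hN₀ : (I.card : ℝ) = N₀)
    (hN₁ : ∀ z ∈ U, z ≠ x → z ≠ y → ((I.filter (fun i => z ∈ W i)).card : ℝ) = N₁)
    (hN₂ : ∀ z ∈ U, ∀ z' ∈ U, z ≠ x → z ≠ y → z' ≠ x → z' ≠ y → z ≠ z' →
      ((I.filter (fun i => z ∈ W i ∧ z' ∈ W i)).card : ℝ) = N₂)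
    (h₁ : ((U.card : ℝ) - 2) * N₁ = ((w : ℝ) - 2) * N₀) (h₂ : ((U.card : ℝ) - 3) * N₂ = ((w : ℝ) - 3) * N₁) :
    ∑ i ∈ I, poolRc (W i) F x y = N₀ * poolCoef U.card w * poolRc U F x y := by
  classical
  -- notation
  set f : ℝ := F x y with hf
  set Dx : ℝ := poolDeg U F x with hDx
  set Dy : ℝ := poolDeg U F y with hDy
  set T : ℝ := poolTot U F with hT
  have hfyx : F y x = f := by rw [hf, hF]
  -- the two marked rows
  have hx_sum : ∑ i ∈ I, poolDeg (W i) F x = N₀ * f + N₁ * (Dx - f) :=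
    sum_poolDeg_marked I W U F hxy hy hWU hWx hWy N₀ N₁ hN₀ hN₁
  have hy_sum : ∑ i ∈ I, poolDeg (W i) F y = N₀ * f + N₁ * (Dy - f) := by
    have h := sum_poolDeg_marked I W U F (Ne.symm hxy) hx hWU hWy hWx N₀ N₁ hN₀
      (fun z hz h1 h2 => hN₁ z hz h2 h1)
    rw [hfyx] at h
    exact h
  -- the total
  have hxU' : x ∈ U := hx
  have hyU' : y ∈ U.erase x := Finset.mem_erase.2 ⟨hxy.symm, hy⟩
  have hrest_x : ∑ a ∈ (U.erase x).erase y, F a x = Dx - f := by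
    have h1 : ∑ a ∈ (U.erase x).erase y, F a x = ∑ a ∈ (U.erase x).erase y, F x a :=
      Finset.sum_congr rfl fun a _ => hF a x
    rw [h1, hDx]
    unfold poolDeg
    rw [← Finset.add_sum_erase _ _ hyU']
    ring
  have hrest_y : ∑ a ∈ (U.erase x).erase y, F a y = Dy - f := by
    have h1 : ∑ a ∈ (U.erase x).erase y, F a y = ∑ a ∈ (U.erase y).erase x, F y a := by
      rw [Finset.erase_right_comm]
      exact Finset.sum_congr rfl fun a _ => hF a y
    have hxU'' : x ∈ U.erase y := Finset.mem_erase.2 ⟨hxy, hx⟩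
    rw [h1, hDy]
    unfold poolDeg
    rw [← Finset.add_sum_erase _ _ hxU'', hfyx]
    ring
  have hrest_D : ∑ a ∈ (U.erase x).erase y, poolDeg U F a = T - Dx - Dy := by
    rw [hT]
    unfold poolTot
    rw [← Finset.add_sum_erase _ _ hxU', ← Finset.add_sum_erase _ _ hyU']
    ring
  have htot_sum : ∑ i ∈ I, poolTot (W i) F =
      (N₀ * f + N₁ * (Dx - f)) + (N₀ * f + N₁ * (Dy - f)) +
        (N₁ * ((Dx - f) + (Dy - f)) + N₂ * ((T - Dx - Dy) - (Dx - f) - (Dy - f))) := by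
    rw [sum_poolTot_eq I W U F hWU, ← Finset.add_sum_erase _ _ hxU', ← Finset.add_sum_erase _ _ hyU']
    have hIx : I.filter (fun i => x ∈ W i) = I := Finset.filter_true_of_mem hWx
    have hIy : I.filter (fun i => y ∈ W i) = I := Finset.filter_true_of_mem hWy
    rw [hIx, hIy, hx_sum, hy_sum]
    have hrest : ∀ a ∈ (U.erase x).erase y, ∑ i ∈ I.filter (fun i => a ∈ W i), poolDeg (W i) F a =
        N₁ * (F a x + F a y) + N₂ * (poolDeg U F a - F a x - F a y) := by
      intro a ha
      simp only [Finset.mem_erase] at ha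
      exact sum_poolDeg_unmarked I W U F hxy hx hy ha.2.2 ha.2.1 ha.1 hWx hWy hWU N₁ N₂ hN₁ hN₂
    rw [Finset.sum_congr rfl hrest, Finset.sum_add_distrib, ← Finset.mul_sum, ← Finset.mul_sum,
      Finset.sum_add_distrib, Finset.sum_sub_distrib, Finset.sum_sub_distrib, hrest_x, hrest_y, hrest_D]
    ring
  -- expand the family sum
  have hrc : ∀ i ∈ I, poolRc (W i) F x y = f - (poolDeg (W i) F x + poolDeg (W i) F y) / ((w : ℝ) - 2) +
      poolTot (W i) F / (((w : ℝ) - 1) * ((w : ℝ) - 2)) := by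
    intro i hi
    unfold poolRc
    rw [hWc i hi]
  rw [Finset.sum_congr rfl hrc, Finset.sum_add_distrib, Finset.sum_sub_distrib, Finset.sum_const, ← Finset.sum_div,
    ← Finset.sum_div, Finset.sum_add_distrib, hx_sum, hy_sum, htot_sum, nsmul_eq_mul, hN₀]
  -- the target
  have hrcU : poolRc U F x y = f - (Dx + Dy) / ((U.card : ℝ) - 2) + T / (((U.card : ℝ) - 1) * ((U.card : ℝ) - 2)) := rfl
  rw [hrcU]
  -- algebra
  have hw4 : (4 : ℝ) ≤ w := by exact_mod_cast hw
  have hu4 : (w : ℝ) ≤ U.card := by exact_mod_cast hwU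
  have hu2 : (U.card : ℝ) - 2 ≠ 0 := by linarith
  have hu3 : (U.card : ℝ) - 3 ≠ 0 := by linarith
  have hu1 : (U.card : ℝ) - 1 ≠ 0 := by linarith
  have hw2 : (w : ℝ) - 2 ≠ 0 := by linarith
  have hw3 : (w : ℝ) - 3 ≠ 0 := by linarith
  have hw1 : (w : ℝ) - 1 ≠ 0 := by linarith
  have hN₁' : N₁ = ((w : ℝ) - 2) * N₀ / ((U.card : ℝ) - 2) := by
    rw [eq_div_iff hu2]; linarith
  have hN₂' : N₂ = ((w : ℝ) - 2) * ((w : ℝ) - 3) * N₀ / (((U.card : ℝ) - 2) * ((U.card : ℝ) - 3)) := by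
    rw [hN₁'] at h₂
    rw [eq_div_iff (mul_ne_zero hu2 hu3)]
    have h2' : ((U.card : ℝ) - 3) * N₂ * ((U.card : ℝ) - 2) = ((w : ℝ) - 3) * (((w : ℝ) - 2) * N₀) := by
      rw [h₂]; field_simp
    linear_combination h2'
  subst hN₁' hN₂'
  unfold poolCoef
  field_simp
  ring

/-- **Superset averaging** (registered form of `sum_poolRc_family`). [new] -/
theorem superset_averaging : ∀ {m : ℕ} {ι : Type} (I : Finset ι) (W : ι → Finset (Fin m)) (U : Finset (Fin m)) (F : Fin m → Fin m → ℝ), (∀ a b, F a b = F b a) → ∀ {x y : Fin m}, x ≠ y → x ∈ U → y ∈ U → ∀ {w : ℕ}, 4 ≤ w → w ≤ U.card → (∀ i ∈ I, (W i).card = w) → (∀ i ∈ I, W i ⊆ U) → (∀ i ∈ I, x ∈ W i) → (∀ i ∈ I, y ∈ W i) → ∀ (N₀ N₁ N₂ : ℝ), (I.card : ℝ) = N₀ → (∀ z ∈ U, z ≠ x → z ≠ y → ((I.filter (fun i => z ∈ W i)).card : ℝ) = N₁) → (∀ z ∈ U, ∀ z' ∈ U, z ≠ x → z ≠ y → z'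 ≠ x → z' ≠ y → z ≠ z' → ((I.filter (fun i => z ∈ W i ∧ z' ∈ W i)).card : ℝ) = N₂) → ((U.card : ℝ) - 2) * N₁ = ((w : ℝ) - 2) * N₀ → ((U.card : ℝ) - 3) * N₂ = ((w : ℝ) - 3) * N₁ → ∑ i ∈ I, poolRc (W i) F x y = N₀ * poolCoef U.card w * poolRc U F x y :=
  fun I W U F hF _ _ hxy hx hy _ hw hwU hWc hWU hWx hWy N₀ N₁ N₂ hN₀ hN₁ hN₂ h₁ h₂ =>
    sum_poolRc_family I W U F hF hxy hx hy hw hwU hWc hWU hWx hWy N₀ N₁ N₂ hN₀ hN₁ hN₂ h₁ h₂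

end

end Summit.PneNP.PneNP.Theorems
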